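import Summits.HubbardSuperconductivity.HubbardSuperconductivity.Theorems.AnisotropyChordChordXYFourNear

/-!
# Route `AnisotropyChord`: **the crux `ChordXY` HOLDS AT `M = 4`** — a kernel-certified instance for every `Δ ∈ [−1, 0]`
(prover seat `hubbard-h0-rotor-p1` g18; `--supports stmt-HubbardSuperconductivity-8146`)

`chordXY_four` is the body of `Theses.AnisotropyChord.ChordXY` with `M := 4`: for every `Δ ∈ [−1, 0]`, every normalised
`Sᶻ_tot = 0` sector ground state `ψ₀` of the KLS point `H₄(0)` and `ψ` of `H₄(Δ) = xxzHamiltonian 1 (torusGraph 2 4) (−1) Δ`: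
`(1 + Δ)·Re⟨ψ₀, S⁺_tot S⁻_tot ψ₀⟩ ≤ Re⟨ψ, S⁺_tot S⁻_tot ψ⟩` (the Tier-A transport chord; the crux asks it for every even `M ≥ 4`).
By Perron uniqueness both sides are the condensates of the sector-`0` Perron amplitudes.  FAR from the KLS point
(`Δ ≤ −17/200`): `Λ(Δ) ≥ (139/2)(1+Δ)` (affine family of class-space PSD certificates, `lowerNormSq_ge_far`) and `Λ₀ ≤ 139/2`
(`lambda0_bounds`).  NEAR the touching point (`−17/200 ≤ Δ ≤ 0`, where the chord is an equality at `Δ = 0` and no finite operator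
inequality certifies it): the first-order perturbative certificate `lowerNormSq_ge_near` (certified symmetric-sector gap at the KLS
point + variance / ceiling certificates + elementary interlacing and `2 × 2` compression bounds).  With `ferroSideChord_four` and
`chordFM_four` (g17) all three chord cruxes of the route now hold at `M = 4`.
-/

set_option linter.style.longLine false
set_option linter.dupNamespace false
set_option autoImplicit false

open Finset Matrix
open Literature.MathematicalPhysics.QuantumLattice Literature.Probability.LatticeModels
open Summit.HubbardSuperconductivity.HubbardSuperconductivity.Theorems.AnisotropyChord.Tower
open Summit.HubbardSuperconductivity.HubbardSuperconductivity.Theorems.AnisotropyChord.InsertionEntropy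
open Summit.HubbardSuperconductivity.HubbardSuperconductivity.Theorems.AnisotropyChord.Transfer
open Summit.HubbardSuperconductivity.HubbardSuperconductivity.Theorems.AnisotropyChord.Stiffness

namespace Summit.HubbardSuperconductivity.HubbardSuperconductivity.Theorems.AnisotropyChord.FourTorus

/-- **the chord for the Perron amplitudes, all `Δ ∈ [−1, 0]`:** `(1+Δ)·‖S⁻a₀‖² ≤ ‖S⁻a‖²`. [folklore] -/
theorem lowerNormSq_chordXY {Δ : ℝ} (h1 : -1 ≤ Δ) (h2 : Δ ≤ 0)
    {a₀ : Cfg → ℝ} (ha₀ : IsPerronSectorGroundAmplitude 4 0 0 a₀)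
    {a : Cfg → ℝ} (ha : IsPerronSectorGroundAmplitude 4 Δ 0 a) :
    (1 + Δ) * lowerNormSq a₀ ≤ lowerNormSq a := by
  by_cases hfar : Δ ≤ -17/200
  · have hf := lowerNormSq_ge_far h1 hfar ha
    have hup := (lambda0_bounds ha₀).2
    have hpos : 0 ≤ 1 + Δ := by linarith
    nlinarith
  · exact lowerNormSq_ge_near (by linarith) h2 ha₀ ha

/-- **THEOREM (the crux `ChordXY` at `M = 4`, all `Δ ∈ [−1, 0]`, kernel-certified):** for every normalised `Sᶻ_tot = 0` sector
ground state `ψ₀` of `H₄(0)` and `ψ` of `H₄(Δ) = xxzHamiltonian 1 (torusGraph 2 4) (−1) Δ` on the `4 × 4` torus,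
`(1 + Δ)·Re⟨ψ₀, S⁺_tot S⁻_tot ψ₀⟩ ≤ Re⟨ψ, S⁺_tot S⁻_tot ψ⟩` — the body of
`Summit.HubbardSuperconductivity.HubbardSuperconductivity.Theses.AnisotropyChord.ChordXY` with `M := 4`
(stmt-HubbardSuperconductivity-8146; instance only, the crux asks for every even `M ≥ 4`).
[conjecture: crux ChordXY of route AnisotropyChord — instance `M = 4` proved here] -/
theorem chordXY_four :
    ∀ Δ ∈ Set.Icc (-1:ℝ) 0, ∀ (ψ₀ ψ : TensorIndex (TorusSite 2 4) 2 → ℂ),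
      ψ₀ ∈ spinZSector (Λ := TorusSite 2 4) 1 0 → star ψ₀ ⬝ᵥ ψ₀ = 1 →
      Matrix.mulVec (xxzHamiltonian 1 (torusGraph 2 4) (-1) 0) ψ₀
        = ((lowestEnergyInSector 1 (xxzHamiltonian 1 (torusGraph 2 4) (-1) 0) 0 : ℝ) : ℂ) • ψ₀ →
      ψ ∈ spinZSector (Λ := TorusSite 2 4) 1 0 → star ψ ⬝ᵥ ψ = 1 →
      Matrix.mulVec (xxzHamiltonian 1 (torusGraph 2 4) (-1) Δ) ψ
        = ((lowestEnergyInSector 1 (xxzHamiltonian 1 (torusGraph 2 4) (-1) Δ) 0 : ℝ) : ℂ) • ψ →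
      (1 + Δ) * (star ψ₀ ⬝ᵥ Matrix.mulVec ((∑ x : TorusSite 2 4, onSite x (spinRaise 1))
            * (∑ y : TorusSite 2 4, onSite y (spinLower 1))) ψ₀).re
        ≤ (star ψ ⬝ᵥ Matrix.mulVec ((∑ x : TorusSite 2 4, onSite x (spinRaise 1))
            * (∑ y : TorusSite 2 4, onSite y (spinLower 1))) ψ).re := by
  intro Δ hΔ ψ₀ ψ hψ₀K hψ₀1 hHψ₀ hψK hψ1 hHψ
  obtain ⟨a₀, ha₀⟩ := exists_perron_zero_of_even (L := 4) 0 (by decide)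
  obtain ⟨a, ha⟩ := exists_perron_zero_of_even (L := 4) Δ (by decide)
  rw [lambda_eq_lowerNormSq_of_sectorGround 0 0 a₀ ha₀ ψ₀ hψ₀K hψ₀1 hHψ₀,
    lambda_eq_lowerNormSq_of_sectorGround Δ 0 a ha ψ hψK hψ1 hHψ]
  exact lowerNormSq_chordXY hΔ.1 hΔ.2 ha₀ ha

end Summit.HubbardSuperconductivity.HubbardSuperconductivity.Theorems.AnisotropyChord.FourTorus
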